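import Literature.NumberTheory.EllipticCurves.FormalGroupNilIdealPointsGroupIso
import Literature.NumberTheory.EllipticCurves.SupersingularReductionTorsionKernel
import Literature.NumberTheory.EllipticCurves.TateModule
import HarnessLib

/-!
# The Tate module of `E(K)` maps injectively to the Tate module of the formal group `Ŵ(𝔪_K)` when `E[p^∞] ⊂ E₁`
# (e.g. at a place of good supersingular reduction)

Topic `Literature/NumberTheory/EllipticCurves`; sequel of `FormalGroupNilIdealPointsGroupIso` (AEC VII.2.2:
`kernelEquivPt : E₁(K) ≃+ Ŵ(𝔪_K)`) and `SupersingularReductionTorsionKernel` (`E[pⁿ] ⊂ E₁` when `Ẽ(k)[p] = 0`).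
Notation: `K` complete ultrametric field, `W` a Weierstrass equation over a coefficient ring `A` acting on `𝒪_K`,
`E = curveOver K W`, `Ŵ(𝔪_K) = W.Pt (ballNilIdeal K)` (the group of `WeierstrassFormalGroupPoints`).

* §1 (any abelian groups) `TateModule.mapOfSubgroup`: a homomorphism `f : H →+ B` defined on a subgroup `H ≤ A` containing
  all the `p`-power torsion of `A` induces a `ℤ_[p]`-linear map `T_p A → T_p B`, injective when `f` is.
* §2 **`tateModuleToPt : T_p E(K) →ₗ[ℤ_p] T_p Ŵ(𝔪_K)`** under the hypothesis `hss : E[pⁿ](K) ⊂ E₁(K)` for all `n` (componentwise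
  `P ↦ z(P)`, `proj_tateModuleToPt`), **injective** (`tateModuleToPt_injective`); and the hypothesis discharged at good reduction
  with `Ẽ(k)[p] = 0` — in particular good SUPERSINGULAR reduction (`mem_kernel_of_pow_prime_smul_eq_zero`,
  `mem_kernel_of_pow_prime_smul_eq_zero_of_hasseCoeff_eq_zero`).

For `K = ℂ_F` and `W` over `ℤ` the target is the `TatePt F p W = T_pŴ(𝒪_{ℂ_F})` of `PAdicHodge/AinfWeierstrassTateModule`
(`maxNilIdealC F` is `ballNilIdeal (CompletedAlgClosure F)` by `rfl`), on which the period maps `∫ω`, `HT` live.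
BSD / K★ (`Cruxes/StarredOptimalManinUnitFiveSeven/Lines/kato-lever-hDR-sector-iii-periods.md` §5 (M2)): infrastructure for the
potentially supersingular cells; nothing about elliptic curves over number fields is proved here. What is NOT here: surjectivity
(every `p`-power torsion point of `Ŵ(𝔪_{ℂ_F})` is algebraic), Galois equivariance along `K̄₀ → ℂ_F`, the passage to
`restrictedRationalTateRep`.

## References
* J. H. Silverman, *The Arithmetic of Elliptic Curves* (2009), III.§7, Prop. VII.2.2, VII.3.1. [SilvermanAEC2009]
* J.-P. Serre, *Propriétés galoisiennes des points d'ordre fini des courbes elliptiques*, Invent. Math. 15 (1972), §1.11. [Serre1972]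
-/

noncomputable section

open scoped Classical NNReal

namespace Literature.NumberTheory.EllipticCurves

/-! ## §1 Tate modules along a partially defined homomorphism -/

namespace TateModule

variable {A : Type*} [AddCommGroup A] {B : Type*} [AddCommGroup B] {p : ℕ}

/-- **Functoriality of `T_p` for a homomorphism defined on a subgroup containing the `p`-power torsion**: for
`H ≤ A` with `A[pⁿ] ⊂ H` for all `n` and `f : H →+ B`, the map `(a_n) ↦ (f a_n)` on compatible sequences.
[cite: SilvermanAEC2009, III.§7] -/
def mapOfSubgroup (H : AddSubgroup A) (hH : ∀ (n : ℕ) (a : A), p ^ n • a = 0 → a ∈ H) (f : H →+ B) :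
    TateModule A p →+ TateModule B p where
  toFun a := TateModule.mk (fun n => f ⟨proj p n a, hH n _ (pow_smul_proj n a)⟩)
    (fun n => by rw [← map_nsmul, ← map_zero f]; congr 1; exact Subtype.ext (pow_smul_proj n a))
    (fun n => by rw [← map_nsmul]; congr 1; exact Subtype.ext (smul_proj_succ n a))
  map_zero' := TateModule.ext fun n => by
    have e : (⟨proj p n (0 : TateModule A p), hH n _ (pow_smul_proj n 0)⟩ : H) = 0 := Subtype.ext (map_zero _)
    rw [proj_mk, e, map_zero, map_zero]
  map_add' a b := TateModule.ext fun n => by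
    have e : (⟨proj p n (a + b), hH n _ (pow_smul_proj n (a + b))⟩ : H) =
        ⟨proj p n a, hH n _ (pow_smul_proj n a)⟩ + ⟨proj p n b, hH n _ (pow_smul_proj n b)⟩ :=
      Subtype.ext (map_add _ _ _)
    rw [proj_mk, e, map_add, map_add, proj_mk, proj_mk]

/-- Components of `mapOfSubgroup`. [cite: SilvermanAEC2009, III.§7] -/
@[simp] theorem proj_mapOfSubgroup (H : AddSubgroup A) (hH : ∀ (n : ℕ) (a : A), p ^ n • a = 0 → a ∈ H) (f : H →+ B)
    (a : TateModule A p) (n : ℕ) :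
    proj p n (mapOfSubgroup H hH f a) = f ⟨proj p n a, hH n _ (pow_smul_proj n a)⟩ := rfl

/-- `mapOfSubgroup` is `ℤ_[p]`-linear (the `ℤ_[p]`-action is componentwise by integers). [cite: SilvermanAEC2009, III.§7] -/
def linearMapOfSubgroup [Fact p.Prime] (H : AddSubgroup A) (hH : ∀ (n : ℕ) (a : A), p ^ n • a = 0 → a ∈ H) (f : H →+ B) :
    TateModule A p →ₗ[ℤ_[p]] TateModule B p :=
  { mapOfSubgroup H hH f with
    map_smul' := fun x a => TateModule.ext fun n => by
      change proj p n (mapOfSubgroup H hH f (x • a)) = proj p n (x • mapOfSubgroup H hH f a)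
      rw [proj_smul, proj_mapOfSubgroup, proj_mapOfSubgroup, ← map_nsmul]
      congr 1 }

/-- Unfolding `linearMapOfSubgroup`. [cite: SilvermanAEC2009, III.§7] -/
@[simp] theorem linearMapOfSubgroup_apply [Fact p.Prime] (H : AddSubgroup A)
    (hH : ∀ (n : ℕ) (a : A), p ^ n • a = 0 → a ∈ H) (f : H →+ B) (a : TateModule A p) :
    linearMapOfSubgroup H hH f a = mapOfSubgroup H hH f a := rfl

/-- `mapOfSubgroup` along an injective `f` is injective. [cite: SilvermanAEC2009, III.§7] -/
theorem mapOfSubgroup_injective (H : AddSubgroup A) (hH : ∀ (n : ℕ) (a : A), p ^ n • a = 0 → a ∈ H) {f : H →+ B}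
    (hf : Function.Injective f) : Function.Injective (mapOfSubgroup (p := p) H hH f) := by
  intro a b h
  refine TateModule.ext fun n => ?_
  have hn := congrArg (proj p n) h
  rw [proj_mapOfSubgroup, proj_mapOfSubgroup] at hn
  exact congrArg Subtype.val (hf hn)

end TateModule

/-! ## §2 `T_p E(K) ↪ T_p Ŵ(𝔪_K)` when the `p`-power torsion lies in `E₁(K)` -/

section Elliptic

open Literature.NumberTheory.GaloisRepresentations.LubinTate
open Literature.NumberTheory.EllipticCurves.FormalGroupChart _root_.WeierstrassCurve

variable {A : Type*} [CommRing A] [UniformSpace A] [DiscreteUniformity A]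
  {K : Type*} [NontriviallyNormedField K] [IsUltrametricDist K] [CompleteSpace K]
  [Algebra A (unitBall K)] [ContinuousSMul A (unitBall K)] {W : WeierstrassCurve A} [hE : (curveOver K W).IsElliptic]
  {p : ℕ}

variable (p W) in
/-- **`T_p E(K) → T_p Ŵ(𝔪_K)`, `(P_n) ↦ (z(P_n))`**, for an integral equation whose `p`-power torsion lies in `E₁(K)`
(`hss`), through the isomorphism `E₁(K) ≃+ Ŵ(𝔪_K)` of AEC VII.2.2 (`kernelEquivPt`); `ℤ_[p]`-linear.
[cite: SilvermanAEC2009, Prop. VII.2.2] [cite: Serre1972, §1.11] -/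
def tateModuleToPt [Fact p.Prime]
    (hss : ∀ (n : ℕ) (P : (curveOver K W).toAffine.Point), p ^ n • P = 0 →
      P ∈ kernel (NormedField.valuation (K := K)) (curveOver K W)) :
    TateModule (curveOver K W).toAffine.Point p →ₗ[ℤ_[p]] TateModule (W.Pt (ballNilIdeal K)) p :=
  TateModule.linearMapOfSubgroup (kernel (NormedField.valuation (K := K)) (curveOver K W)) hss
    (kernelEquivPt K W).toAddMonoidHom

/-- Components: the `n`-th coordinate of the image is `z(P_n) ∈ 𝔪_K`. [cite: SilvermanAEC2009, Prop. VII.2.2] -/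
theorem proj_tateModuleToPt_val [Fact p.Prime]
    (hss : ∀ (n : ℕ) (P : (curveOver K W).toAffine.Point), p ^ n • P = 0 →
      P ∈ kernel (NormedField.valuation (K := K)) (curveOver K W))
    (τ : TateModule (curveOver K W).toAffine.Point p) (n : ℕ) :
    (TateModule.proj p n (tateModuleToPt W p hss τ)).val =
      zPt (TateModule.proj p n τ) (hss n _ (TateModule.pow_smul_proj n τ)) := rfl

/-- In `K`: the `n`-th coordinate of the image is `z(P_n) = -x(P_n)/y(P_n)`. [cite: SilvermanAEC2009, Prop. VII.2.2] -/
theorem coe_proj_tateModuleToPt [Fact p.Prime]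
    (hss : ∀ (n : ℕ) (P : (curveOver K W).toAffine.Point), p ^ n • P = 0 →
      P ∈ kernel (NormedField.valuation (K := K)) (curveOver K W))
    (τ : TateModule (curveOver K W).toAffine.Point p) (n : ℕ) :
    (((TateModule.proj p n (tateModuleToPt W p hss τ)).val : unitBall K) : K) = (TateModule.proj p n τ).zCoord := rfl

/-- **`T_p E(K) → T_p Ŵ(𝔪_K)` is injective.** [cite: SilvermanAEC2009, Prop. VII.2.2] [cite: Serre1972, §1.11] -/
theorem tateModuleToPt_injective [Fact p.Prime]
    (hss : ∀ (n : ℕ) (P : (curveOver K W).toAffine.Point), p ^ n • P = 0 →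
      P ∈ kernel (NormedField.valuation (K := K)) (curveOver K W)) :
    Function.Injective (tateModuleToPt W p hss) :=
  TateModule.mapOfSubgroup_injective _ hss (kernelEquivPt K W).injective

omit [UniformSpace A] [DiscreteUniformity A] [CompleteSpace K] [ContinuousSMul A (unitBall K)] hE in
/-- **The hypothesis at good reduction with `Ẽ(k)[p] = 0`**: if the integral model `W ⊗ 𝒪_K` has unit discriminant and its
reduction has no point of order `p` over the residue field of `𝒪_K`, every `pⁿ`-torsion point of `E(K)` lies in `E₁(K)`
(`SupersingularReductionTorsionKernel`). [cite: SilvermanAEC2009, Prop. VII.2.1] -/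
theorem mem_kernel_of_pow_prime_smul_eq_zero (hΔ : IsUnit (ballIntModel K W).Δ)
    (hred : ∀ Q : ((ballIntModel K W).map (IsLocalRing.residue (unitBall K))).toAffine.Point, (p : ℤ) • Q = 0 → Q = 0)
    (n : ℕ) (P : (curveOver K W).toAffine.Point) (hP : p ^ n • P = 0) :
    P ∈ kernel (NormedField.valuation (K := K)) (curveOver K W) := by
  rcases P with _ | ⟨x, y, h⟩
  · exact (kernel (NormedField.valuation (K := K)) (curveOver K W)).zero_mem
  · refine some_mem_kernel _ ?_
    have hP' : (p ^ n : ℤ) • (WeierstrassCurve.Affine.Point.some x y h : (curveOver K W).toAffine.Point) = 0 := by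
      rw [← hP, ← natCast_zsmul]; norm_cast
    exact one_lt_v_X_of_pow_prime_smul_eq_zero (W := ballIntModel K W) (Valuation.integer.integers _) hΔ hred hP'

omit [UniformSpace A] [DiscreteUniformity A] [CompleteSpace K] [ContinuousSMul A (unitBall K)] hE in
/-- **Good supersingular reduction** (finite residue field of odd characteristic `p`, Hasse invariant of the reduction `= 0`):
every `pⁿ`-torsion point of `E(K)` lies in `E₁(K)`, so `tateModuleToPt` is available and injective.
[cite: SilvermanAEC2009, Thm. V.3.1(a) and Prop. VII.2.1] [cite: Serre1972, §1.11] -/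
theorem mem_kernel_of_pow_prime_smul_eq_zero_of_hasseCoeff_eq_zero [Fact p.Prime] (hp2 : p ≠ 2)
    [Finite (IsLocalRing.ResidueField (unitBall K))] [CharP (IsLocalRing.ResidueField (unitBall K)) p]
    (hΔ : IsUnit (ballIntModel K W).Δ)
    (hA : ((ballIntModel K W).map (IsLocalRing.residue (unitBall K))).hasseCoeff p = 0)
    (n : ℕ) (P : (curveOver K W).toAffine.Point) (hP : p ^ n • P = 0) :
    P ∈ kernel (NormedField.valuation (K := K)) (curveOver K W) := by
  rcases P with _ | ⟨x, y, h⟩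
  · exact (kernel (NormedField.valuation (K := K)) (curveOver K W)).zero_mem
  · refine some_mem_kernel _ ?_
    have hP' : (p ^ n : ℤ) • (WeierstrassCurve.Affine.Point.some x y h : (curveOver K W).toAffine.Point) = 0 := by
      rw [← hP, ← natCast_zsmul]; norm_cast
    exact one_lt_v_X_of_pow_prime_smul_eq_zero_of_hasseCoeff_eq_zero (W := ballIntModel K W)
      (Valuation.integer.integers _) hΔ hp2 hA hP'

end Elliptic

end Literature.NumberTheory.EllipticCurves

end

/-! ## §3 (appended) The inverse map and the isomorphism `T_p E(K) ≃ T_p Ŵ(𝔪_K)` under `E[p^∞] ⊂ E₁` -/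

noncomputable section

namespace Literature.NumberTheory.EllipticCurves

section EllipticIso

open scoped Classical NNReal
open Literature.NumberTheory.GaloisRepresentations.LubinTate
open Literature.NumberTheory.EllipticCurves.FormalGroupChart _root_.WeierstrassCurve

variable {A : Type*} [CommRing A] [UniformSpace A] [DiscreteUniformity A]
  {K : Type*} [NontriviallyNormedField K] [IsUltrametricDist K] [CompleteSpace K]
  [Algebra A (unitBall K)] [ContinuousSMul A (unitBall K)] {W : WeierstrassCurve A} [hE : (curveOver K W).IsElliptic]
  {p : ℕ}

variable (K W p) in
/-- **`T_p Ŵ(𝔪_K) → T_p E(K)`, `(t_n) ↦ (P(t_n))`** (always defined: `ptHom : Ŵ(𝔪_K) →+ E(K)` is a homomorphism, AEC VII.2.2);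
`ℤ_[p]`-linear and injective. [cite: SilvermanAEC2009, Prop. VII.2.2] -/
def tateModuleOfPt [Fact p.Prime] : TateModule (W.Pt (ballNilIdeal K)) p →ₗ[ℤ_[p]] TateModule (curveOver K W).toAffine.Point p :=
  TateModule.map p (ptHom K W)

/-- Components of `tateModuleOfPt`: `P(t_n)`. [cite: SilvermanAEC2009, Prop. VII.2.2] -/
@[simp] theorem proj_tateModuleOfPt [Fact p.Prime] (τ : TateModule (W.Pt (ballNilIdeal K)) p) (n : ℕ) :
    TateModule.proj p n (tateModuleOfPt K W p τ) = ptOfZ K W (TateModule.proj p n τ).val := rfl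

/-- `tateModuleOfPt` is injective (`t ↦ P(t)` is). [cite: SilvermanAEC2009, Prop. VII.2.2] -/
theorem tateModuleOfPt_injective [Fact p.Prime] : Function.Injective (tateModuleOfPt K W p) := by
  intro a b h
  refine TateModule.ext fun n => ptHom_injective ?_
  have hn := congrArg (TateModule.proj p n) h
  rwa [proj_tateModuleOfPt, proj_tateModuleOfPt] at hn

/-- `tateModuleToPt ∘ tateModuleOfPt = id`: `z(P(t)) = t`. [cite: SilvermanAEC2009, Prop. VII.2.2] -/
theorem tateModuleToPt_tateModuleOfPt [Fact p.Prime]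
    (hss : ∀ (n : ℕ) (P : (curveOver K W).toAffine.Point), p ^ n • P = 0 →
      P ∈ kernel (NormedField.valuation (K := K)) (curveOver K W))
    (τ : TateModule (W.Pt (ballNilIdeal K)) p) : tateModuleToPt W p hss (tateModuleOfPt K W p τ) = τ :=
  TateModule.ext fun n => WeierstrassCurve.Pt.ext (by
    rw [proj_tateModuleToPt_val]
    exact (zPt_ptOfZ _).trans rfl)

/-- `tateModuleOfPt ∘ tateModuleToPt = id`: `P(z(P)) = P` on `E₁(K)`. [cite: SilvermanAEC2009, Prop. VII.2.2] -/
theorem tateModuleOfPt_tateModuleToPt [Fact p.Prime]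
    (hss : ∀ (n : ℕ) (P : (curveOver K W).toAffine.Point), p ^ n • P = 0 →
      P ∈ kernel (NormedField.valuation (K := K)) (curveOver K W))
    (τ : TateModule (curveOver K W).toAffine.Point p) : tateModuleOfPt K W p (tateModuleToPt W p hss τ) = τ :=
  TateModule.ext fun n => by
    rw [proj_tateModuleOfPt, proj_tateModuleToPt_val]
    exact (eq_ptOfZ_zPt _).symm

variable (W p) in
/-- **`T_p E(K) ≃ₗ[ℤ_p] T_p Ŵ(𝔪_K)` when `E[p^∞](K) ⊂ E₁(K)`** (e.g. good supersingular reduction,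
`mem_kernel_of_pow_prime_smul_eq_zero_of_hasseCoeff_eq_zero`): the Tate module of the curve over `K` IS the Tate module of its
formal group. For `K = ℂ_F`, `W/ℤ`, the right side is `TatePt F p W` of `PAdicHodge/AinfWeierstrassTateModule`.
[cite: SilvermanAEC2009, Prop. VII.2.2] [cite: Serre1972, §1.11] -/
def tateModuleEquivPt [Fact p.Prime]
    (hss : ∀ (n : ℕ) (P : (curveOver K W).toAffine.Point), p ^ n • P = 0 →
      P ∈ kernel (NormedField.valuation (K := K)) (curveOver K W)) :
    TateModule (curveOver K W).toAffine.Point p ≃ₗ[ℤ_[p]] TateModule (W.Pt (ballNilIdeal K)) p :=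
  { tateModuleToPt W p hss with
    invFun := tateModuleOfPt K W p
    left_inv := tateModuleOfPt_tateModuleToPt hss
    right_inv := tateModuleToPt_tateModuleOfPt hss }

/-- Unfolding `tateModuleEquivPt`. [cite: SilvermanAEC2009, Prop. VII.2.2] -/
@[simp] theorem tateModuleEquivPt_apply [Fact p.Prime]
    (hss : ∀ (n : ℕ) (P : (curveOver K W).toAffine.Point), p ^ n • P = 0 →
      P ∈ kernel (NormedField.valuation (K := K)) (curveOver K W))
    (τ : TateModule (curveOver K W).toAffine.Point p) : tateModuleEquivPt W p hss τ = tateModuleToPt W p hss τ := rfl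

/-- Unfolding the inverse of `tateModuleEquivPt`. [cite: SilvermanAEC2009, Prop. VII.2.2] -/
@[simp] theorem tateModuleEquivPt_symm_apply [Fact p.Prime]
    (hss : ∀ (n : ℕ) (P : (curveOver K W).toAffine.Point), p ^ n • P = 0 →
      P ∈ kernel (NormedField.valuation (K := K)) (curveOver K W))
    (τ : TateModule (W.Pt (ballNilIdeal K)) p) : (tateModuleEquivPt W p hss).symm τ = tateModuleOfPt K W p τ := rfl

end EllipticIso

end Literature.NumberTheory.EllipticCurves

end
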